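import Literature.NumberTheory.GaloisRepresentations.KummerTwo
import Literature.NumberTheory.GaloisRepresentations.ArtinSchreierTwo
import Literature.NumberTheory.GaloisRepresentations.PPrimaryDevissage
import Literature.NumberTheory.GaloisRepresentations.CohomologicalDimensionC1
import Literature.NumberTheory.GaloisRepresentations.IndexCoprimeTransfer
import Mathlib.NumberTheory.Cyclotomic.Gal
import Mathlib.RingTheory.RootsOfUnity.AlgebraicallyClosed
import HarnessLib

/-!
# Proof of Tsen's theorem on the Galois side: `cd_p(K) ≤ 1` for `trdeg_{k₀} K = 1` (Serre II §3.3 (b))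

This file discharges the named fact
`Literature.NumberTheory.GaloisRepresentations.tsen_fieldCdLE_one_of_trdeg_eq_one`
(`CohomologicalDimension.lean`): for `k₀` algebraically closed and `trdeg_{k₀} K = 1`,
`cd_p(K) ≤ 1` for every prime `p`.  The tree already reduces it
(`tsen_fieldCdLE_one_of_trdeg_eq_one_of_norm_surjective`, `CohomologicalDimensionC1.lean`: Tsen's
theorem `K` is `C₁`, and `C₁ ⇒` all norms of finite Galois extensions of finite separable
extensions are onto) to the implication **(iv) bis ⇒ (i) of Serre II §3.1 Prop. 5**: a field `k`
all of whose finite layers `L/K/k` have surjective norms has `cd_p(G_k) ≤ 1` for every prime `p`.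
This is `fieldCdLE_one_of_norm_surjective` below, assembled from the chain of files of this
directory following Serre's proof:

* `cd_p(Γ_k) ≤ 1 ⟸ H²(Γ_k, M) = 0` for `p`-primary torsion `M`
  (`groupCdLE_one_of_forall_subsingleton_two`),
  `⟸` the same for finite `M` (`subsingleton_of_forall_finite`, Serre I §2.2 Cor. 2);
* for finite `M`: `M` is trivial on `Gal(K̄/E₀)`, `E₀/k` finite Galois; with a Sylow `p`-subgroup
  `P ≤ Gal(E₀/k)` and `H = Gal(K̄/E₀^P)` (index prime to `p`,
  `subsingleton_of_isOpen_of_index_coprime`,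
  Serre I §3.3 Cor. 1) one descends to `H`, which acts through the `p`-group `P`; dévissage
  (`subsingleton_two_of_pGroup_quotient`) reduces to `H²(H, ℤ/p) = 0` with trivial action;
* `p ≠ char k`: `ℤ/p ≅ μ_p` over `H ∩ Gal(K̄/k(ζ_p))` (index dividing `p - 1`), and
  `H²(·, μ_p) = 0` by Kummer theory, Hilbert 90 and the vanishing of the `p`-part of the Brauer
  groups of the finite separable extensions of `k` under (iv) bis
  (`subsingleton_two_mu_of_norm_surjective`: local triviality of cochains, Sylow descent along
  cyclic layers whose `H²` is "invariants mod norms", Serre II §3.1 / *Corps locaux* X §7);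
* `p = char k`: `ℤ/p ⊆ K̄` by Artin–Schreier and `H¹ = H² = 0` for `K̄`
  (`subsingleton_two_primeRep_of_charP`, Serre II §2.2 Prop. 3).

## References

* J.-P. Serre, *Cohomologie galoisienne* (1997), II §3.1 Prop. 5, II §3.2 Cor., II §3.3 (b),
  II §2.2 Prop. 3, I §3.3 Cor. 1. [SerreGaloisCohomology1997]
* S. S. Shatz, *Profinite groups, arithmetic, and geometry* (1972), Ch. IV §3 Thm. 24.
  [Shatz1972]
-/

noncomputable section

open CategoryTheory Topology Filter Field IntermediateField

universe u

namespace Literature.NumberTheory.GaloisRepresentations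

open _root_.TopRep _root_.ContRepresentation _root_.ContinuousCohomology DiscreteGaloisModule
  LocalWeilDatum

attribute [local instance] compactSpace_of_isClosed_subgroup

variable {k : Type u} [Field k]

/-! ### The cyclotomic subgroup `Gal(K̄/k(ζ_p))` -/

/-- **`Gal(K̄/k(ζ_p))`**: for `p ≠ char k` there is an open normal subgroup of `Γ_k` of index
prime to `p` (indeed dividing `p - 1`: `Gal(k(ζ_p)/k) ↪ (ℤ/p)ˣ`,
`IsPrimitiveRoot.autToPow_injective`) fixing the `p`-th roots of unity of `K̄`.
[cite: SerreGaloisCohomology1997, II §3.1, proof of Prop. 5] -/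
theorem exists_galFixing_cyclotomic {p : ℕ} [hp : Fact p.Prime] [NeZero ((p : ℕ) : k)] :
    ∃ S₀ : Subgroup (absoluteGaloisGroup k), S₀.Normal ∧ IsOpen (S₀ : Set (absoluteGaloisGroup k)) ∧
      S₀.index.Coprime p ∧ ∀ σ ∈ S₀, ∀ ζ : rootsOfUnity p (AlgebraicClosure k),
        σ • (ζ : (AlgebraicClosure k)ˣ) = ζ := by
  classical
  haveI := AlgebraicClosure.hasEnoughRootsOfUnity k p
  haveI : NeZero p := ⟨hp.out.ne_zero⟩
  obtain ⟨ζ₀, hζ₀⟩ := HasEnoughRootsOfUnity.exists_primitiveRoot (AlgebraicClosure k) p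
  let L : IntermediateField k (AlgebraicClosure k) := k⟮ζ₀⟯
  haveI : FiniteDimensional k L :=
    IntermediateField.adjoin.finiteDimensional (Algebra.IsIntegral.isIntegral ζ₀)
  haveI : IsCyclotomicExtension {p} k L :=
    IsPrimitiveRoot.intermediateField_adjoin_isCyclotomicExtension (K := k) hζ₀
  haveI : IsGalois k L := IsCyclotomicExtension.isGalois {p} k L
  refine ⟨galFixing k L, normal_galFixing L, isOpen_galFixing k L, ?_, ?_⟩
  · -- the index divides `p - 1`
    have hidx : (galFixing k L).index = Nat.card (L ≃ₐ[k] L) := by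
      rw [← ker_resGal, Subgroup.index_ker, MonoidHom.range_eq_top.2 (resGal_surjective L),
        Subgroup.card_top]
    let ζL : L := ⟨ζ₀, mem_adjoin_simple_self k ζ₀⟩
    have hζL : IsPrimitiveRoot ζL p := IsPrimitiveRoot.coe_submonoidClass_iff.1 hζ₀
    have hinj : Function.Injective (hζL.autToPow k) :=
      IsPrimitiveRoot.autToPow_injective (K := k) (hμ := hζL)
    have hdvd : Nat.card (L ≃ₐ[k] L) ∣ p - 1 := by
      rw [Nat.card_congr (MonoidHom.ofInjective hinj).toEquiv, ← ZMod.card_units p,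
        ← Nat.card_eq_fintype_card]
      exact Subgroup.card_subgroup_dvd_card _
    rw [hidx]
    refine Nat.Coprime.coprime_dvd_left hdvd ?_
    refine ((Nat.Prime.coprime_iff_not_dvd hp.out).2 fun h => ?_).symm
    exact Nat.not_dvd_of_pos_of_lt (Nat.sub_pos_of_lt hp.out.one_lt)
      (Nat.sub_lt hp.out.pos one_pos) h
  · intro σ hσ ζ
    have hfix : σ • ζ₀ = ζ₀ := (mem_galFixing_iff k).1 hσ ζ₀ (mem_adjoin_simple_self k ζ₀)
    obtain ⟨i, -, hi⟩ := hζ₀.eq_pow_of_pow_eq_one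
      (show (((ζ : (AlgebraicClosure k)ˣ) : AlgebraicClosure k)) ^ p = 1 from by
        rw [← Units.val_pow_eq_pow_val, (mem_rootsOfUnity _ _).1 ζ.2, Units.val_one])
    apply Units.ext
    rw [Units.coe_smul, ← hi, smul_pow', hfix]

/-! ### `H²(H, ℤ/p) = 0` for open `H` and the trivial module of order `p` -/

/-- **`H²(H, W) = 0` for every open `H ≤ Γ_k` and every finite `W` of prime order `p` with trivial
action**, under hypothesis (iv) bis: for `p ≠ char k`, `W ≅ μ_p` over `H ∩ Gal(K̄/k(ζ_p))` (index
prime to `p`) where `subsingleton_two_mu_of_norm_surjective` applies; for `p = char k`,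
`W ≅ 𝔽_p ⊆ K̄` and `subsingleton_two_primeRep_of_charP` applies.
[cite: SerreGaloisCohomology1997, II §3.1 Prop. 5 and II §2.2 Prop. 3] -/
theorem subsingleton_two_of_trivial_card_prime
    (hNorm : ∀ (K L : Type u) [Field K] [Field L] [Algebra k K] [Algebra K L]
      [FiniteDimensional k K] [Algebra.IsSeparable k K] [FiniteDimensional K L] [IsGalois K L],
      Function.Surjective (Algebra.norm K (S := L)))
    {p : ℕ} [hp : Fact p.Prime] (H : Subgroup (absoluteGaloisGroup k))
    (hH : IsOpen (H : Set (absoluteGaloisGroup k)))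
    (W : Type u) [AddCommGroup W] [TopologicalSpace W] [DiscreteTopology W] [Finite W]
    (σ : ContinuousRep H ℤ W) (htriv : ∀ (g : H) (w : W), σ g w = w) (hcard : Nat.card W = p) :
    Subsingleton (continuousCohomology 2 σ.toTopRep) := by
  classical
  haveI := absoluteGaloisGroup_compactSpace k
  haveI : IsClosed (H : Set (absoluteGaloisGroup k)) := Subgroup.isClosed_of_isOpen H hH
  by_cases h0 : ((p : ℕ) : k) = 0
  · -- `p = char k`: Artin–Schreier
    haveI : CharP k p := (CharP.charP_iff_prime_eq_zero hp.out).2 h0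
    haveI : Finite (primeSub k p) :=
      Nat.finite_of_card_ne_zero (by rw [natCard_primeSub]; exact hp.out.ne_zero)
    exact subsingleton_of_trivial_of_card_eq ((primeRep k p).restrict (subgroupIncl H)) σ
      (fun g w => primeRep_apply k p _ w) htriv (natCard_primeSub k p) hcard 2
      (subsingleton_two_primeRep_of_charP H hH)
  · -- `p ≠ char k`: Kummer over `H' = H ∩ Gal(K̄/k(ζ_p))`
    haveI : NeZero ((p : ℕ) : k) := ⟨h0⟩
    haveI : NeZero p := ⟨hp.out.ne_zero⟩
    haveI := AlgebraicClosure.hasEnoughRootsOfUnity k p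
    obtain ⟨S₀, hS₀n, hS₀o, hS₀c, hS₀fix⟩ := exists_galFixing_cyclotomic (k := k) (p := p)
    haveI := hS₀n
    let H' : Subgroup (absoluteGaloisGroup k) := S₀ ⊓ H
    have hH'o : IsOpen (H' : Set (absoluteGaloisGroup k)) := by
      change IsOpen ((S₀ : Set (absoluteGaloisGroup k)) ∩ H)
      exact hS₀o.inter hH
    have hle : H' ≤ H := inf_le_right
    -- `H²(H', μ_p) = 0`
    have s1 := subsingleton_two_mu_of_norm_surjective hNorm H' hH'o (p := p)
    -- `μ_p ≅ W` over `H'` (both trivial of order `p`)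
    let σ' : ContinuousRep H' ℤ W := σ.restrict (inclCMH hle)
    have hmu : ∀ (g : H') (v : MuCarrier k p), (mu k p).restrict (subgroupIncl H') g v = v := by
      intro g v
      apply MuCarrier.toAdditive.injective
      rw [ContinuousRep.restrict_apply, subgroupIncl_apply, mu_apply_apply]
      apply congrArg Additive.ofMul
      apply Subtype.ext
      rw [absoluteGaloisGroup.coe_smul_rootsOfUnity]
      exact hS₀fix _ g.2.1 _
    have hcmu : Nat.card (MuCarrier k p) = p := by
      change Nat.card (rootsOfUnity p (AlgebraicClosure k)) = p
      exact HasEnoughRootsOfUnity.natCard_rootsOfUnity _ p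
    haveI : Finite (MuCarrier k p) :=
      Nat.finite_of_card_ne_zero (by rw [hcmu]; exact hp.out.ne_zero)
    have s2 : Subsingleton (continuousCohomology 2 σ'.toTopRep) :=
      subsingleton_of_trivial_of_card_eq ((mu k p).restrict (subgroupIncl H')) σ' hmu
        (fun g w => htriv _ w) hcmu hcard 2 s1
    -- transport to the subgroup `H' ∩ H ≤ H` and up to `H` (index prime to `p`)
    have s3 : Subsingleton (continuousCohomology 2
        (σ.restrict (subgroupIncl (H'.subgroupOf H))).toTopRep) :=
      (subsingleton_iff_of_continuousMulEquiv (Subgroup.subgroupOfContinuousMulEquivOfLe hle) σ'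
        (σ.restrict (subgroupIncl (H'.subgroupOf H))) (fun _ _ => rfl) 2).1 s2
    have hM : IsPrimaryTorsion p W := fun w => ⟨1, by
      rw [pow_one]
      exact addOrderOf_dvd_iff_nsmul_eq_zero.1 (hcard ▸ addOrderOf_dvd_natCard w)⟩
    have hSo : IsOpen ((H'.subgroupOf H : Subgroup H) : Set H) := by
      change IsOpen ((Subtype.val : H → absoluteGaloisGroup k) ⁻¹'
        (H' : Set (absoluteGaloisGroup k)))
      exact hH'o.preimage continuous_subtype_val
    have hcop : (H'.subgroupOf H).index.Coprime p := by
      change ((S₀ ⊓ H).relIndex H).Coprime p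
      rw [Subgroup.inf_relIndex_right]
      exact Nat.Coprime.coprime_dvd_left (Subgroup.relIndex_dvd_index_of_normal S₀ H) hS₀c
    exact subsingleton_of_isOpen_of_index_coprime σ hM hSo hcop 1 s3

/-! ### `H²(Γ_k, M) = 0` for finite `p`-primary `M` -/

/-- **`H²(Γ_k, M) = 0` for every finite `p`-primary discrete `Γ_k`-module**, under hypothesis
(iv) bis: `M` is trivial on `Gal(K̄/E₀)` for a finite Galois `E₀/k`; with a Sylow `p`-subgroup
`P` of `Gal(E₀/k)` and `H = Gal(K̄/E₀^P)` (open of index prime to `p`) it suffices to treat `H`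
(`subsingleton_of_isOpen_of_index_coprime`), which acts on `M` through the `p`-group `P`, so the
dévissage `subsingleton_two_of_pGroup_quotient` and `subsingleton_two_of_trivial_card_prime`
apply. [cite: SerreGaloisCohomology1997, II §3.1 Prop. 5, I §3.3 Cor. 1] -/
theorem subsingleton_two_of_finite
    (hNorm : ∀ (K L : Type u) [Field K] [Field L] [Algebra k K] [Algebra K L]
      [FiniteDimensional k K] [Algebra.IsSeparable k K] [FiniteDimensional K L] [IsGalois K L],
      Function.Surjective (Algebra.norm K (S := L)))
    {p : ℕ} [hp : Fact p.Prime] (B : Type u) [AddCommGroup B] [TopologicalSpace B]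
    [DiscreteTopology B] [Finite B] (τ₀ : ContinuousRep (absoluteGaloisGroup k) ℤ B)
    (hB : IsPrimaryTorsion p B) : Subsingleton (continuousCohomology 2 τ₀.toTopRep) := by
  classical
  haveI := absoluteGaloisGroup_compactSpace k
  -- the kernel is open: `Gal(K̄/E₀)` acts trivially for a finite Galois `E₀/k`
  have hU : (⋂ b : B, {σ : absoluteGaloisGroup k | τ₀ σ b = b}) ∈ 𝓝 (1 : absoluteGaloisGroup k) :=
    (Filter.iInter_mem).2 fun b => τ₀.setOf_apply_eq_mem_nhds_one b
  obtain ⟨E₀, hfin, hgal, hE₀⟩ := exists_finiteDimensional_isGalois_galFixing_subset (k := k) hU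
  haveI := hfin
  haveI := hgal
  have hker : ∀ σ ∈ galFixing k E₀, ∀ b : B, τ₀ σ b = b := fun σ hσ b =>
    Set.mem_iInter.1 (hE₀ hσ) b
  -- Sylow `p`-subgroup of `Gal(E₀/k)` and `H = Gal(K̄/E₀^P)`
  obtain ⟨P⟩ := (Sylow.nonempty : Nonempty (Sylow p (E₀ ≃ₐ[k] E₀)))
  haveI : FiniteDimensional k (lift (fixedField (P : Subgroup (E₀ ≃ₐ[k] E₀)))) :=
    (liftAlgEquiv (fixedField (P : Subgroup (E₀ ≃ₐ[k] E₀)))).toLinearEquiv.finiteDimensional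
  set H : Subgroup (absoluteGaloisGroup k) :=
    galFixing k (lift (fixedField (P : Subgroup (E₀ ≃ₐ[k] E₀)))) with hHdef
  have hHP : H = (P : Subgroup (E₀ ≃ₐ[k] E₀)).comap (resGal E₀) :=
    galFixing_lift_fixedField E₀ (P : Subgroup (E₀ ≃ₐ[k] E₀))
  have hHopen : IsOpen (H : Set (absoluteGaloisGroup k)) := isOpen_galFixing k _
  haveI : IsClosed (H : Set (absoluteGaloisGroup k)) := isClosed_galFixing k _
  have hHidx : H.index.Coprime p := by
    rw [hHdef, index_galFixing_lift_fixedField]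
    exact ((Nat.Prime.coprime_iff_not_dvd hp.out).2 P.not_dvd_index).symm
  -- `H` acts through `P`: `N₀ = ker (H → P)` acts trivially, `H/N₀ ↪ P` is a `p`-group
  let φ : H →* (P : Subgroup (E₀ ≃ₐ[k] E₀)) :=
    ((resGal E₀).comp H.subtype).codRestrict _ fun h =>
      Subgroup.mem_comap.1 (hHP.le h.2)
  haveI : Finite (H ⧸ φ.ker) :=
    Finite.of_injective (QuotientGroup.kerLift φ) (QuotientGroup.kerLift_injective φ)
  have hQ : IsPGroup p (H ⧸ φ.ker) :=
    P.isPGroup'.of_injective (QuotientGroup.kerLift φ) (QuotientGroup.kerLift_injective φ)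
  have hN₀ : ∀ g ∈ φ.ker, ∀ b : B, (τ₀.restrict (subgroupIncl H)) g b = b := by
    intro g hg b
    rw [MonoidHom.mem_ker] at hg
    have h1 : resGal E₀ (g : absoluteGaloisGroup k) = 1 :=
      congrArg (fun x : (P : Subgroup (E₀ ≃ₐ[k] E₀)) => (x : E₀ ≃ₐ[k] E₀)) hg
    have h2 : (g : absoluteGaloisGroup k) ∈ galFixing k E₀ := by
      rw [← ker_resGal]
      exact h1
    exact hker _ h2 b
  refine subsingleton_of_isOpen_of_index_coprime τ₀ hB hHopen hHidx 1 ?_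
  exact subsingleton_two_of_pGroup_quotient φ.ker hQ
    (fun W _ _ _ _ σ hσ hW => subsingleton_two_of_trivial_card_prime hNorm H hHopen W σ hσ hW)
    B (τ₀.restrict (subgroupIncl H)) hB hN₀

/-! ### Serre II §3.1 Prop. 5, (iv) bis ⇒ (i), and the discharge -/

/-- **Serre II §3.1 Prop. 5, (iv) bis ⇒ (i)**: if for every finite separable `K/k` and finite
Galois `L/K` the norm `N_{L/K} : L → K` is onto, then `cd_p(k) ≤ 1` for every prime `p`.
[cite: SerreGaloisCohomology1997, II §3.1 Prop. 5] -/
theorem fieldCdLE_one_of_norm_surjective (k : Type u) [Field k]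
    (hNorm : ∀ (K L : Type u) [Field K] [Field L] [Algebra k K] [Algebra K L]
      [FiniteDimensional k K] [Algebra.IsSeparable k K] [FiniteDimensional K L] [IsGalois K L],
      Function.Surjective (Algebra.norm K (S := L)))
    (p : ℕ) [hp : Fact p.Prime] : FieldCdLE k p 1 := by
  haveI := absoluteGaloisGroup_compactSpace k
  change GroupCdLE (absoluteGaloisGroup k) p 1
  exact groupCdLE_one_of_forall_subsingleton_two fun M _ _ _ ρ hM =>
    subsingleton_of_forall_finite ρ hp.out.ne_zero 1
      (fun B _ _ _ _ τ hB => subsingleton_two_of_finite hNorm B τ hB) hM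

/-- **Tsen's theorem on the Galois side** (discharge of the named fact
`tsen_fieldCdLE_one_of_trdeg_eq_one`, Serre II §3.3 (b)): for `k₀` algebraically closed and
`trdeg_{k₀} K = 1`, `cd_p(K) ≤ 1` for every prime `p`.  Tsen (`K` is `C₁`,
`Literature.FieldTheory.QuasiAlgClosed`), Serre II §3.2 Cor. (`C₁ ⇒` surjective norms) and
II §3.1 Prop. 5 (`fieldCdLE_one_of_norm_surjective`), through the tree's reduction
`tsen_fieldCdLE_one_of_trdeg_eq_one_of_norm_surjective`.
[cite: SerreGaloisCohomology1997, II §3.3 (b), II §3.2 Cor., II §3.1 Prop. 5]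
[cite: Shatz1972, Ch. IV §3 Thm. 24] -/
theorem tsen_fieldCdLE_one_of_trdeg_eq_one_holds : tsen_fieldCdLE_one_of_trdeg_eq_one.{u} :=
  tsen_fieldCdLE_one_of_trdeg_eq_one_of_norm_surjective fun k _ hNorm p _ =>
    fieldCdLE_one_of_norm_surjective k hNorm p

end Literature.NumberTheory.GaloisRepresentations

end
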